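import Summits.Ventures.PercRepro.Defs
import Summits.Ventures.PercRepro.Conditioning
import Summits.Ventures.PercRepro.Graph
import Summits.Ventures.PercRepro.FlipConcavity
import Summits.Ventures.PercRepro.StrictFlip
import Summits.Ventures.PercRepro.Cell3
import Summits.Ventures.PercRepro.MinimalConfig
import Summits.Ventures.PercRepro.PairSumStrictA

/-!
# The strict pair-sum inequality, part B (p6, gen 2; split for the 400-line lint)

Continuation of `PairSumStrictA.lean` (same namespaces): **`exists_negative_pair`** and **`MultiGraph.pair_sum_lt`**
(the pair-sum inequality is strict when no marked vertex separates the other two).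
-/

namespace PercRepro
open Finset
variable {E : Type*}
namespace MultiGraph
variable {V : Type*} {G : MultiGraph V E}


/-! ### The negative pair -/

section NegativePair

variable [Fintype E] [DecidableEq E]

/-- **Existence of a negative pair of transitions.**  If each of the three partitions
`{a,b}|c`, `{b,c}|a`, `{a,c}|b` is realised by some configuration, then there are an edge `e` and
two configurations `η, η'` with `e` closed whose transitions at `e` are
`(bot → pac, bot → pbc)`, `(pab → top, pbc → top)` or `(pab → top, pac → top)`. -/
theorem exists_negative_pair (G : MultiGraph V E) (a b c : V)
    (hP : ∃ ω, G.Conn ω a b ∧ ¬ G.Conn ω a c) (hS : ∃ ω, G.Conn ω b c ∧ ¬ G.Conn ω b a)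
    (hR : ∃ ω, G.Conn ω a c ∧ ¬ G.Conn ω a b) :
    ∃ (e : E) (η η' : Config E), η e = false ∧ η' e = false ∧
      ((G.cell3 a b c η = Cell3.bot ∧ G.cell3 a b c (Function.update η e true) = Cell3.pac ∧
        G.cell3 a b c η' = Cell3.bot ∧ G.cell3 a b c (Function.update η' e true) = Cell3.pbc) ∨
       (G.cell3 a b c η = Cell3.pab ∧ G.cell3 a b c (Function.update η e true) = Cell3.top ∧
        G.cell3 a b c η' = Cell3.pbc ∧ G.cell3 a b c (Function.update η' e true) = Cell3.top) ∨
       (G.cell3 a b c η = Cell3.pab ∧ G.cell3 a b c (Function.update η e true) = Cell3.top ∧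
        G.cell3 a b c η' = Cell3.pac ∧ G.cell3 a b c (Function.update η' e true) = Cell3.top)) := by
  obtain ⟨P, hPab, hPac, hPmin⟩ := exists_minimal_conn hP
  obtain ⟨S, hSbc, hSba, -⟩ := exists_minimal_conn hS
  obtain ⟨R, hRac, hRab, -⟩ := exists_minimal_conn hR
  have hab : a ≠ b := fun h => hSba (by rw [h]; exact Conn.refl G S b)
  have hac : a ≠ c := fun h => hPac (by rw [h]; exact Conn.refl G P c)
  have hbc : b ≠ c := fun h => hRab (by rw [h]; exact hRac)
  -- the attachment of `c` to the cluster of `a` in `P`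
  have hcW : c ∉ G.cluster P a := hPac
  obtain ⟨Q, e, v, w, -, hwW, hend, hcv, hnot⟩ :=
    exists_attach_edge (G := G) hcW ⟨S, b, hPab, hSbc.symm⟩
  have hwW' : G.Conn P a w := hwW
  have hQ'e : Function.update Q e false e = false := by simp
  have hCW : ∀ y, G.Conn (Function.update Q e false) c y → ¬ G.Conn P a y :=
    fun y hy hyW => hnot y hy hyW
  have hvW : ¬ G.Conn P a v := hCW v hcv
  have hPe : P e = false := by
    by_contra h
    have h' : P e = true := by simpa using h
    obtain ⟨h1, h2⟩ := conn_endpoints_of_minimal hPab hPmin h'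
    rcases hend with ⟨hv, _⟩ | ⟨_, hv⟩
    · exact hvW (hv ▸ h1)
    · exact hvW (hv ▸ h2)
  by_cases hwa : w = a
  · -- Case `w = a`: `(pab → top, pbc → top)`
    obtain ⟨hηe, hηab, hηac, hηwc⟩ :=
      joinConfig_spec (G := G) hPab hPac hCW hcv hQ'e hPe hend
    have hηbc : ¬ G.Conn (G.joinConfig P (Function.update Q e false) a c) b c :=
      fun h => hηac (hηab.trans h)
    have hη1 := cell3_eq_pab_iff.2 ⟨hηab, hηbc⟩
    have hηac' : G.Conn (Function.update (G.joinConfig P (Function.update Q e false) a c) e true)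
        a c := by
      have h := hηwc
      rw [hwa] at h
      exact h
    have hη2 := cell3_eq_top_iff.2 ⟨hηab.mono (le_update_true _ _),
      (hηab.mono (le_update_true _ _)).symm.trans hηac'⟩
    have hQa : ¬ G.Conn (Function.update Q e false) c a := fun h => hCW a h (Conn.refl G P a)
    have hend' : (G.fst e = v ∧ G.snd e = a) ∨ (G.fst e = a ∧ G.snd e = v) := by
      rw [← hwa]; exact hend
    obtain ⟨hη'e, hη'iso, hη'bc, hη'ac⟩ :=
      joinConfig_third_spec (G := G) hSbc hSba hQa hcv hQ'e hend'
    have hη'1 := cell3_eq_pbc_iff.2 ⟨fun h => hab (conn_eq_of_no_open_edge hη'iso h.symm).symm,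
      fun h => hac (conn_eq_of_no_open_edge hη'iso h.symm).symm, hη'bc⟩
    have hη'2 := cell3_eq_top_iff.2 ⟨hη'ac.trans (hη'bc.mono (le_update_true _ _)).symm,
      hη'bc.mono (le_update_true _ _)⟩
    exact ⟨e, _, _, hηe, hη'e, Or.inr (Or.inl ⟨hη1, hη2, hη'1, hη'2⟩)⟩
  · by_cases hwb : w = b
    · -- Case `w = b`: `(pab → top, pac → top)`
      obtain ⟨hηe, hηab, hηac, hηwc⟩ :=
        joinConfig_spec (G := G) hPab hPac hCW hcv hQ'e hPe hend
      have hηbc : ¬ G.Conn (G.joinConfig P (Function.update Q e false) a c) b c :=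
        fun h => hηac (hηab.trans h)
      have hη1 := cell3_eq_pab_iff.2 ⟨hηab, hηbc⟩
      have hηbc' : G.Conn (Function.update (G.joinConfig P (Function.update Q e false) a c) e true)
          b c := by
        have h := hηwc
        rw [hwb] at h
        exact h
      have hη2 := cell3_eq_top_iff.2 ⟨hηab.mono (le_update_true _ _), hηbc'⟩
      have hQb : ¬ G.Conn (Function.update Q e false) c b := fun h => hCW b h hPab
      have hend' : (G.fst e = v ∧ G.snd e = b) ∨ (G.fst e = b ∧ G.snd e = v) := by
        rw [← hwb]; exact hend
      obtain ⟨hη'e, hη'iso, hη'ac, hη'bc⟩ :=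
        joinConfig_third_spec (G := G) hRac hRab hQb hcv hQ'e hend'
      have hη'1 := cell3_eq_pac_iff.2 ⟨fun h => hab (conn_eq_of_no_open_edge hη'iso h), hη'ac⟩
      have hη'2 := cell3_eq_top_iff.2 ⟨(hη'ac.mono (le_update_true _ _)).trans hη'bc.symm, hη'bc⟩
      exact ⟨e, _, _, hηe, hη'e, Or.inr (Or.inr ⟨hη1, hη2, hη'1, hη'2⟩)⟩
    · -- Case `w ∉ {a, b}`: `(bot → pac, bot → pbc)`
      have hPmin' : ∀ g, P g = true → ¬ G.Conn (Function.update P g false) b a :=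
        fun g hg h => hPmin g hg h.symm
      have hPbc : ¬ G.Conn P b c := fun h => hPac (hPab.trans h)
      have hwWb : G.Conn P b w := hPab.symm.trans hwW'
      have hCW' : ∀ y, G.Conn (Function.update Q e false) c y → ¬ G.Conn P b y :=
        fun y hy h => hCW y hy (hPab.trans h)
      obtain ⟨hηe, hηiso, hηiso', hηac, hηac'⟩ :=
        sideConfig_spec (G := G) hPab hPmin hPac hwW' hwa hwb hCW hcv hQ'e hPe hend
      obtain ⟨hη'e, hη'iso, hη'iso', hη'bc, hη'bc'⟩ :=
        sideConfig_spec (G := G) hPab.symm hPmin' hPbc hwWb hwb hwa hCW' hcv hQ'e hPe hend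
      have hη1 := cell3_eq_bot_iff.2 ⟨fun h => hab (conn_eq_of_no_open_edge hηiso h), hηac,
        fun h => hbc (conn_eq_of_no_open_edge hηiso h.symm).symm⟩
      have hη2 := cell3_eq_pac_iff.2 ⟨fun h => hab (conn_eq_of_no_open_edge hηiso' h), hηac'⟩
      have hη'1 := cell3_eq_bot_iff.2 ⟨fun h => hab (conn_eq_of_no_open_edge hη'iso h.symm).symm,
        fun h => hac (conn_eq_of_no_open_edge hη'iso h.symm).symm, hη'bc⟩
      have hη'2 := cell3_eq_pbc_iff.2 ⟨fun h => hab (conn_eq_of_no_open_edge hη'iso' h.symm).symm,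
        fun h => hac (conn_eq_of_no_open_edge hη'iso' h.symm).symm, hη'bc'⟩
      exact ⟨e, _, _, hηe, hη'e, Or.inl ⟨hη1, hη2, hη'1, hη'2⟩⟩

end NegativePair

/-! ### Strictness of the pair-sum inequality -/

section Main

variable [Fintype E] [DecidableEq E]

omit [Fintype E] in
/-- The mixed second differences of the pair-sum form of `cell3` are nonpositive. -/
theorem pairSumForm_cell3_bracket_nonpos (G : MultiGraph V E) (a b c : V) (e : E)
    (ω ω' : Config E) :
    Cell3.pairSumForm (G.cell3 a b c (Function.update ω e true))
        (G.cell3 a b c (Function.update ω' e true))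
      - Cell3.pairSumForm (G.cell3 a b c (Function.update ω e true))
        (G.cell3 a b c (Function.update ω' e false))
      - Cell3.pairSumForm (G.cell3 a b c (Function.update ω e false))
        (G.cell3 a b c (Function.update ω' e true))
      + Cell3.pairSumForm (G.cell3 a b c (Function.update ω e false))
        (G.cell3 a b c (Function.update ω' e false)) ≤ 0 := by
  rcases cell3_update_step (G := G) (a := a) (b := b) (c := c) e ω with h | h <;>
    rcases cell3_update_step (G := G) (a := a) (b := b) (c := c) e ω' with h' | h'
  · rw [h, h']
    linarith
  · rw [h]
    linarith
  · rw [h']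
    linarith
  · exact Cell3.pairSumForm_merge _ _ _ _ h h'

/-- **Strict pair-sum inequality.**  If every edge probability lies in `(0, 1)` and each of the
partitions `{a,b}|c`, `{b,c}|a`, `{a,c}|b` is realised by some configuration (no marked vertex
separates the other two), then `y₁ y₂ + y₁ y₃ + y₂ y₃ < x z`. -/
theorem pair_sum_lt {p : E → ℝ} (hp : ∀ e, 0 < p e ∧ p e < 1) (G : MultiGraph V E) (a b c : V)
    (hP : ∃ ω, G.Conn ω a b ∧ ¬ G.Conn ω a c) (hS : ∃ ω, G.Conn ω b c ∧ ¬ G.Conn ω b a)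
    (hR : ∃ ω, G.Conn ω a c ∧ ¬ G.Conn ω a b) :
    prob p (G.connEvent a b ∩ G.sepEvent a c) * prob p (G.connEvent a c ∩ G.sepEvent a b)
      + prob p (G.connEvent a b ∩ G.sepEvent a c) * prob p (G.connEvent b c ∩ G.sepEvent a b)
      + prob p (G.connEvent a c ∩ G.sepEvent a b) * prob p (G.connEvent b c ∩ G.sepEvent a b)
      < prob p (G.connEvent a b ∩ G.connEvent b c)
          * prob p (G.sepEvent a b ∩ G.sepEvent a c ∩ G.sepEvent b c) := by
  obtain ⟨e, η, η', hηe, hη'e, hcase⟩ := exists_negative_pair G a b c hP hS hR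
  have key := expect2_pos_of_flipConcave hp
    (B := fun ω ω' => Cell3.pairSumForm (G.cell3 a b c ω) (G.cell3 a b c ω'))
    (fun ω => by rw [Cell3.pairSumForm_self]) (pairSumForm_cell3_bracket_nonpos G a b c)
    e η η' hηe hη'e ?_
  · rw [expect2_pairSumForm, cell3_preimage_top, cell3_preimage_pab, cell3_preimage_pac,
      cell3_preimage_pbc, cell3_preimage_bot] at key
    linarith
  · have h0 : Function.update η e false = η := Function.update_eq_self_iff.2 hηe.symm
    have h0' : Function.update η' e false = η' := Function.update_eq_self_iff.2 hη'e.symm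
    simp only [h0, h0']
    rcases hcase with ⟨h1, h2, h3, h4⟩ | ⟨h1, h2, h3, h4⟩ | ⟨h1, h2, h3, h4⟩ <;>
      rw [h1, h2, h3, h4] <;> norm_num [Cell3.pairSumForm]

end Main

end MultiGraph

end PercRepro

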